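import Literature.Geometry.Riemannian.HarmonicMaps
import Literature.Geometry.Riemannian.PullbackFamilyDerivative
import Literature.Geometry.Riemannian.TimeDerivativeContinuity
import Literature.Geometry.Lorentzian.CurvatureRegularity
import Literature.Geometry.Lorentzian.MetricDetComparison
import Literature.Geometry.Lorentzian.VolumeProofs
import Mathlib.Analysis.Calculus.ParametricIntegral
import Mathlib.Topology.Homotopy.Basic
import HarnessLib

/-!
# The energy along smooth deformations; energy-minimising maps and constant maps are harmonic
(topic `Geometry/Riemannian`)

The variational layer under the harmonic-map vocabulary of `HarmonicMaps.lean`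
(`HarmonicMap.energyDensity`, `HarmonicMap.energy`, `IsHarmonicMap` = `C^∞` critical point of
the energy along every `C^∞` deformation; Eells–Ratto 1993, Ch. I (1.3)–(1.4), (1.8)–(1.9),
held copy PDF pp. 13–15, READ), needed by every existence proof of harmonic maps that ends
with "the limit / the minimiser is a critical point of `E`" — in particular by both lines of
attack on the named fact `Literature.Geometry.Riemannian.eellsSampson_existence`
(`EellsSampson.lean`; the heat flow of Eells–Sampson and the direct minimisation in a homotopy
class). Everything here is PROVED; there are no definitions and no named facts.

* `contMDiff_energyDensity_family` — for a `C^∞` deformation `F : ℝ → M → N` the energy density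
  `(x, t) ↦ e(F_t)(x)` is `C^∞` on `M × ℝ` (local frames: `e = ½ ∑ᵢⱼ (G⁻¹)ⱼᵢ (F_t^* h)(sᵢ, sⱼ)`,
  `trace_eq_sum_gram_inv`, with the tree's `IsContMDiffFamilyOn.pullbackBilin` and Mathlib's
  `ContMDiffWithinAt.clm_bundle_apply₂`).
* `hasDerivAt_energy_family` — on a compact manifold without boundary, `t ↦ E(F_t)` is
  differentiable with `d/dt E(F_t) = ∫_M ∂ₜ e(F_t) dμ_g` (Eells–Ratto, proof of (1.9), Step 1:
  "`d/dt E(φ_t)|₀ = ½ ∫_M ∂/∂t ⟨dφ_t, dφ_t⟩|₀ dx`"; differentiation under the integral sign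
  against the finite Riemannian measure, the time derivative being jointly continuous,
  `continuous_deriv_time`).
* `isHarmonicMap_of_isLocalMin`, `isHarmonicMap_of_energy_le_of_homotopic` — a smooth map which
  locally minimises `E` along every smooth deformation, in particular a smooth map minimising `E`
  among the smooth maps homotopic to it, is harmonic (Eells–Ratto (1.8): critical points "or
  extrema" of `E`).
* `energyDensity_nonneg`, `energy_nonneg`, `isHarmonicMap_const` — for a Riemannian target the
  energy is `≥ 0`, so constant maps (energy `0`, `HarmonicMap.energy_const`) are harmonic
  (Eells–Ratto (1.3): "`e(φ) ≡ 0` on an open set iff `φ` is constant there").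
* `exists_isHarmonicMap_homotopic_of_homotopic_const` — the Eells–Sampson statement for
  NULL-HOMOTOPIC maps, in the format of `eellsSampson_existence`, with no curvature hypothesis.

Two pieces of general infrastructure, proved here because the tree's versions assume a
boundaryless MODEL (`I.Boundaryless`) while `eellsSampson_existence` only assumes
`BoundarylessManifold`: `isOpen_extChartAt_target_of_boundarylessManifold` (targets of extended
charts are open, by Mathlib's smooth invariance of the interior
`isInteriorPoint_iff_of_mem_atlas`) and `continuous_deriv_time` (the time derivative of a
function `C^∞` on `M × ℝ` is jointly continuous; compare `continuousOn_derivWithin_time`,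
`TimeDerivativeContinuity.lean`).

## References

* J. Eells, A. Ratto, *Harmonic Maps and Minimal Immersions with Symmetries*, Annals of
  Mathematics Studies 130, Princeton University Press (1993), Ch. I, (1.3)–(1.4), (1.8)–(1.9)
  and the proof of (1.9), Step 1. Held copy, PDF pp. 13–15. [EellsRatto1993]
* J. Eells, J. H. Sampson, *Harmonic mappings of Riemannian manifolds*, Amer. J. Math. 86
  (1964) 109–160, §1–§2 (energy, tension field, first variation; examples). [EellsSampson1964]
-/

noncomputable section

open Bundle Set Module MeasureTheory Function Filter
open scoped Manifold ContDiff Topology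

namespace Literature.Geometry.Riemannian

open Lorentzian Lorentzian.PseudoRiemannianMetric

/-! ### Extended charts of a manifold without boundary have open targets -/

section Boundaryless

variable {E : Type*} [NormedAddCommGroup E] [NormedSpace ℝ E] {H : Type*} [TopologicalSpace H]
  {I : ModelWithCorners ℝ E H} {M : Type*} [TopologicalSpace M] [ChartedSpace H M]
  [IsManifold I ∞ M] [BoundarylessManifold I M]

/-- On a `C^∞` manifold without boundary (`BoundarylessManifold I M`; the model `I` itself may
have boundary or corners) the target of every extended chart is **open** in the model vector
space: by the smooth invariance of the interior (Mathlib's `isInteriorPoint_iff_of_mem_atlas`)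
every point of the target is an interior point of it. [folklore] -/
theorem isOpen_extChartAt_target_of_boundarylessManifold (x : M) :
    IsOpen (extChartAt I x).target := by
  rw [← interior_eq_iff_isOpen]
  refine Subset.antisymm interior_subset fun y hy => ?_
  set x' := (extChartAt I x).symm y with hx'
  have hx's : x' ∈ (chartAt H x).source := by
    rw [← extChartAt_source I]; exact (extChartAt I x).map_target hy
  have hint : I.IsInteriorPoint x' := BoundarylessManifold.isInteriorPoint (I := I)
  have key := (I.isInteriorPoint_iff_of_mem_atlas (n := ∞) (by simp) (chart_mem_atlas H x)
    hx's).1 hint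
  have : (chartAt H x).extend I x' = y := (extChartAt I x).right_inv hy
  rwa [this] at key

/-! ### Time derivatives of functions smooth on `M × ℝ` (no boundary on the model needed) -/

/-- **The time derivative of a function `C^∞` on `M × ℝ` is jointly continuous**, for `M`
without boundary in the sense `BoundarylessManifold` (compare `continuousOn_derivWithin_time`,
`TimeDerivativeContinuity.lean`, which assumes a boundaryless MODEL): with
`û(y, t) = u t (φ⁻¹ y)` the chart representative (`contDiffOn_time_chart`, `C^∞` on the open set
`φ.target × ℝ`), `∂ₜu(t, x) = D û(φ x, t) · (0, 1)` and `D û` is continuous. [folklore] -/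
theorem continuous_deriv_time {u : ℝ → M → ℝ}
    (hu : ContMDiff (I.prod 𝓘(ℝ, ℝ)) 𝓘(ℝ, ℝ) ∞ (fun p : M × ℝ => u p.2 p.1)) :
    Continuous fun z : M × ℝ => deriv (fun s => u s z.1) z.2 := by
  rw [continuous_iff_continuousAt]
  rintro ⟨x₀, t₀⟩
  set φ := extChartAt I x₀ with hφ
  set û : E × ℝ → ℝ := fun q => u q.2 (φ.symm q.1) with hû_def
  have hu' : ContMDiffOn (I.prod 𝓘(ℝ, ℝ)) 𝓘(ℝ, ℝ) ((⊤ : ℕ∞) : ℕ∞ω) (fun p : M × ℝ => u p.2 p.1)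
      (univ ×ˢ univ) := hu.contMDiffOn
  have hû : ContDiffOn ℝ ((⊤ : ℕ∞) : ℕ∞ω) û (φ.target ×ˢ univ) := contDiffOn_time_chart hu' x₀
  have hO : IsOpen (φ.target ×ˢ (univ : Set ℝ)) :=
    (isOpen_extChartAt_target_of_boundarylessManifold x₀).prod isOpen_univ
  have hDc : ContinuousOn (fderiv ℝ û) (φ.target ×ˢ univ) :=
    hû.continuousOn_fderiv_of_isOpen hO (by exact_mod_cast le_top)
  -- the slice derivative is `D û (φ x, t) (0, 1)` on `φ.source × ℝ`
  have hslice : ∀ x ∈ φ.source, ∀ t : ℝ,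
      HasDerivAt (fun s => u s x) (fderiv ℝ û (φ x, t) ((0 : E), (1 : ℝ))) t := by
    intro x hx t
    have hmem : (φ x, t) ∈ φ.target ×ˢ (univ : Set ℝ) := ⟨φ.map_source hx, mem_univ _⟩
    have hd : HasFDerivAt û (fderiv ℝ û (φ x, t)) (φ x, t) :=
      ((hû.contDiffAt (hO.mem_nhds hmem)).differentiableAt (by simp)).hasFDerivAt
    have hc : HasDerivAt (fun s : ℝ => ((φ x, s) : E × ℝ)) ((0 : E), (1 : ℝ)) t :=
      (hasDerivAt_const t (φ x)).prodMk (hasDerivAt_id t)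
    have hcomp := hd.comp_hasDerivAt t hc
    have heq : (fun s => u s x) = û ∘ fun s : ℝ => ((φ x, s) : E × ℝ) := by
      funext s
      simp only [hû_def, comp_apply, φ.left_inv hx]
    rwa [heq]
  have hagree : ∀ z ∈ φ.source ×ˢ (univ : Set ℝ), deriv (fun s => u s z.1) z.2 =
      fderiv ℝ û (φ z.1, z.2) ((0 : E), (1 : ℝ)) := fun z hz => (hslice z.1 hz.1 z.2).deriv
  have hψ : ContinuousOn (fun z : M × ℝ => (φ z.1, z.2)) (φ.source ×ˢ univ) :=
    ((continuousOn_extChartAt x₀).comp continuous_fst.continuousOn fun z hz => hz.1).prodMk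
      continuous_snd.continuousOn
  have hmaps : MapsTo (fun z : M × ℝ => (φ z.1, z.2)) (φ.source ×ˢ univ) (φ.target ×ˢ univ) :=
    fun z hz => ⟨φ.map_source hz.1, mem_univ _⟩
  have hcomp : ContinuousOn (fun z : M × ℝ => fderiv ℝ û (φ z.1, z.2) ((0 : E), (1 : ℝ)))
      (φ.source ×ˢ univ) :=
    ((ContinuousLinearMap.apply ℝ ℝ ((0 : E), (1 : ℝ))).continuous.comp_continuousOn
      (hDc.comp hψ hmaps) :)
  have hloc : ContinuousOn (fun z : M × ℝ => deriv (fun s => u s z.1) z.2) (φ.source ×ˢ univ) :=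
    hcomp.congr hagree
  exact hloc.continuousAt ((isOpen_extChartAt_source x₀).prod isOpen_univ |>.mem_nhds
    ⟨mem_extChartAt_source x₀, mem_univ _⟩)

omit [IsManifold I ∞ M] [BoundarylessManifold I M] in
/-- Slices `s ↦ u s x` of a function `C^∞` on `M × ℝ` are differentiable, with derivative
`deriv`. [folklore] -/
theorem hasDerivAt_time_slice {u : ℝ → M → ℝ}
    (hu : ContMDiff (I.prod 𝓘(ℝ, ℝ)) 𝓘(ℝ, ℝ) ∞ (fun p : M × ℝ => u p.2 p.1)) (x : M) (t : ℝ) :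
    HasDerivAt (fun s => u s x) (deriv (fun s => u s x) t) t := by
  have h1 : ContMDiff 𝓘(ℝ, ℝ) 𝓘(ℝ, ℝ) ∞ (fun s : ℝ => u s x) :=
    hu.comp (contMDiff_const.prodMk contMDiff_id)
  have h2 : Differentiable ℝ (fun s : ℝ => u s x) :=
    (contMDiff_iff_contDiff.1 h1).differentiable (by simp)
  exact (h2 t).hasDerivAt

end Boundaryless

/-! ### The energy density of a smooth family of maps is smooth on `M × ℝ` -/

section Family

variable {EM : Type*} [NormedAddCommGroup EM] [NormedSpace ℝ EM] [FiniteDimensional ℝ EM]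
  {HM : Type*} [TopologicalSpace HM] {IM : ModelWithCorners ℝ EM HM}
  {M : Type*} [TopologicalSpace M] [ChartedSpace HM M] [IsManifold IM ∞ M]
  {EN : Type*} [NormedAddCommGroup EN] [NormedSpace ℝ EN]
  {HN : Type*} [TopologicalSpace HN] {IN : ModelWithCorners ℝ EN HN}
  {N : Type*} [TopologicalSpace N] [ChartedSpace HN N] [IsManifold IN ∞ N]

variable (g : ContMDiffRiemannianMetric IM ∞ EM (TangentSpace IM : M → Type _))
  (h : PseudoRiemannianMetric IN ∞ EN (TangentSpace IN : N → Type _))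

set_option maxSynthPendingDepth 2 in
-- nested operator spaces `EM →L EM →L ℝ` over the tangent fibres
/-- **The energy density of a smooth family is smooth in space and time.** For a `C^∞`
deformation `F : ℝ → M → N` (`(t, x) ↦ F t x` jointly `C^∞`) the energy density
`(x, t) ↦ e(F_t)(x) = ½ tr_{g_x} (F_t^* h)_x` (`HarmonicMap.energyDensity`, Eells–Ratto 1993,
Ch. I (1.3)) is `C^∞` on `M × ℝ`. In the local frame `sᵢ` of the trivialisation of `TM` at `x₀`,
`e(F_t)(x) = ½ ∑ᵢⱼ (G(x)⁻¹)ⱼᵢ (F_t^* h)_x(sᵢ x, sⱼ x)` (`trace_eq_sum_gram_inv`) with `G` the Gram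
matrix of the frame (smooth inverse: `contMDiffOn_gram_localFrame_inv`) and `(F_t^* h)_x` a smooth
family of forms (`IsContMDiffFamilyOn.pullbackBilin`) evaluated on smooth frame fields
(`ContMDiffWithinAt.clm_bundle_apply₂`). [cite: EellsRatto1993, Ch. I (1.3)] -/
theorem contMDiff_energyDensity_family {F : ℝ → M → N}
    (hF : ContMDiff (𝓘(ℝ, ℝ).prod IM) IN ∞ (fun p : ℝ × M => F p.1 p.2)) :
    ContMDiff (IM.prod 𝓘(ℝ, ℝ)) 𝓘(ℝ, ℝ) ∞
      (fun q : M × ℝ => HarmonicMap.energyDensity g h (F q.2) q.1) := by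
  classical
  -- the family in the tree's `M × ℝ` convention
  have hF' : ContMDiffOn (IM.prod 𝓘(ℝ, ℝ)) IN ∞ (fun q : M × ℝ => F q.2 q.1) (univ ×ˢ univ) :=
    (hF.comp (contMDiff_snd.prodMk contMDiff_fst)).contMDiffOn
  -- the pulled-back forms `(F_t^* h)_x`: a smooth family of sections of `Hom(TM, Hom(TM, ℝ))`
  have hfam := (isContMDiffFamilyOn_const h univ).pullbackBilin hF'
  -- smoothness near each point, in the local frame of the trivialisation of `TM` at `x₀`
  rw [← contMDiffOn_univ]
  rintro ⟨x₀, t₀⟩ -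
  set e := trivializationAt EM (TangentSpace IM : M → Type _) x₀ with he
  set bE := Module.finBasis ℝ EM with hbE
  have hx₀ : x₀ ∈ e.baseSet := FiberBundle.mem_baseSet_trivializationAt' x₀
  -- frame fields along `q ↦ q.1`
  have hs : ∀ i, ContMDiffOn (IM.prod 𝓘(ℝ, ℝ)) IM.tangent ∞
      (fun q : M × ℝ => (TotalSpace.mk' EM q.1 (e.localFrame bE i q.1) : TangentBundle IM M))
      (e.baseSet ×ˢ univ) := fun i =>
    (e.contMDiffOn_localFrame_baseSet ∞ bE i).comp contMDiffOn_fst fun q hq => hq.1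
  -- the components `(F_t^* h)_x (sᵢ x, sⱼ x)` are smooth on `e.baseSet × ℝ`
  have hcomp : ∀ i j, ContMDiffOn (IM.prod 𝓘(ℝ, ℝ)) 𝓘(ℝ, ℝ) ∞
      (fun q : M × ℝ => pullbackBilin (I := IN) (I' := IM) (F q.2) h.val q.1
        (e.localFrame bE i q.1) (e.localFrame bE j q.1)) (e.baseSet ×ˢ univ) := by
    intro i j q hq
    have h1 : ContMDiffWithinAt (IM.prod 𝓘(ℝ, ℝ)) (IM.prod 𝓘(ℝ, ℝ)) ∞
        (fun q : M × ℝ => TotalSpace.mk' ℝ (E := Bundle.Trivial M ℝ) q.1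
          (pullbackBilin (I := IN) (I' := IM) (F q.2) h.val q.1
            (e.localFrame bE i q.1) (e.localFrame bE j q.1))) (e.baseSet ×ˢ univ) q := by
      apply ContMDiffWithinAt.clm_bundle_apply₂ (F₁ := EM) (F₂ := EM)
      · exact (hfam.mono (prod_mono (subset_univ _) (subset_univ _))) q hq
      · exact hs i q hq
      · exact hs j q hq
    exact (contMDiffWithinAt_totalSpace.1 h1).2
  -- the inverse Gram matrix of the frame is smooth
  have hG : ∀ i j, ContMDiffOn (IM.prod 𝓘(ℝ, ℝ)) 𝓘(ℝ, ℝ) ∞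
      (fun q : M × ℝ => (Matrix.of fun i j => (ofRiemannian g).val q.1 (e.localFrame bE i q.1)
        (e.localFrame bE j q.1))⁻¹ i j) (e.baseSet ×ˢ univ) := fun i j =>
    (contMDiffOn_gram_localFrame_inv e (ofRiemannian g) bE i j).comp contMDiffOn_fst
      fun q hq => hq.1
  -- the trace formula in the frame
  have formula : ∀ q ∈ e.baseSet ×ˢ (univ : Set ℝ),
      HarmonicMap.energyDensity g h (F q.2) q.1 = (1 / 2 : ℝ) * ∑ i, ∑ j,
        (Matrix.of fun i j => (ofRiemannian g).val q.1 (e.localFrame bE i q.1)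
          (e.localFrame bE j q.1))⁻¹ j i *
        pullbackBilin (I := IN) (I' := IM) (F q.2) h.val q.1
          (e.localFrame bE i q.1) (e.localFrame bE j q.1) := by
    rintro ⟨x, t⟩ ⟨hx, -⟩
    dsimp only
    rw [HarmonicMap.energyDensity_eq,
      trace_eq_sum_gram_inv (ofRiemannian g) x (e.basisAt bE hx)]
    simp only [e.localFrame_apply_of_mem_baseSet bE hx]
    rfl
  have hrhs : ContMDiffOn (IM.prod 𝓘(ℝ, ℝ)) 𝓘(ℝ, ℝ) ∞ (fun q : M × ℝ => (1 / 2 : ℝ) * ∑ i, ∑ j,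
        (Matrix.of fun i j => (ofRiemannian g).val q.1 (e.localFrame bE i q.1)
          (e.localFrame bE j q.1))⁻¹ j i *
        pullbackBilin (I := IN) (I' := IM) (F q.2) h.val q.1
          (e.localFrame bE i q.1) (e.localFrame bE j q.1)) (e.baseSet ×ˢ univ) := by
    intro q hq
    refine contMDiffWithinAt_const.mul ?_
    refine contMDiffWithinAt_finsetSum fun i _ => contMDiffWithinAt_finsetSum fun j _ => ?_
    exact (hG j i q hq).mul (hcomp i j q hq)
  have hloc : ContMDiffOn (IM.prod 𝓘(ℝ, ℝ)) 𝓘(ℝ, ℝ) ∞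
      (fun q : M × ℝ => HarmonicMap.energyDensity g h (F q.2) q.1) (e.baseSet ×ˢ univ) :=
    hrhs.congr formula
  exact (hloc.contMDiffAt ((e.open_baseSet.prod isOpen_univ).mem_nhds ⟨hx₀, mem_univ _⟩))
    |>.contMDiffWithinAt

end Family

/-! ### The energy along a smooth deformation is differentiable (closed `M`) -/

section Energy

variable {EM : Type*} [NormedAddCommGroup EM] [NormedSpace ℝ EM] [FiniteDimensional ℝ EM]
  {HM : Type*} [TopologicalSpace HM] {IM : ModelWithCorners ℝ EM HM}
  {M : Type*} [TopologicalSpace M] [ChartedSpace HM M] [IsManifold IM ∞ M]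
  [BoundarylessManifold IM M] [CompactSpace M] [T3Space M] [MeasurableSpace M] [BorelSpace M]
  {EN : Type*} [NormedAddCommGroup EN] [NormedSpace ℝ EN]
  {HN : Type*} [TopologicalSpace HN] {IN : ModelWithCorners ℝ EN HN}
  {N : Type*} [TopologicalSpace N] [ChartedSpace HN N] [IsManifold IN ∞ N]

variable (g : ContMDiffRiemannianMetric IM ∞ EM (TangentSpace IM : M → Type _))
  (h : PseudoRiemannianMetric IN ∞ EN (TangentSpace IN : N → Type _))

omit [BoundarylessManifold IM M] in
/-- The Riemannian measure of a compact manifold is finite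
(`riemannianVolume_lt_top_of_isCompact_holds`). [folklore] -/
theorem isFiniteMeasure_riemannianMeasure' : IsFiniteMeasure (riemannianMeasure g) :=
  ⟨riemannianVolume_lt_top_of_isCompact_holds g le_rfl isCompact_univ⟩

/-- **Differentiation of the energy under the integral sign.** On a compact manifold `M`
without boundary, for a `C^∞` deformation `F : ℝ → M → N` the energy `t ↦ E(F_t) = ∫_M e(F_t) dμ_g`
(`HarmonicMap.energy`; Eells–Ratto 1993, Ch. I (1.4), (1.8), and the proof of (1.9), Step 1:
"`d/dt E(φ_t)|₀ = ½ ∫_M ∂/∂t ⟨dφ_t, dφ_t⟩|₀ dx`") is differentiable at every `t₀`,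
with derivative `∫_M ∂ₜ e(F_t)(x)|_{t₀} dμ_g(x)`: the energy density is `C^∞` on `M × ℝ`
(`contMDiff_energyDensity_family`), so its time derivative is jointly continuous
(`continuous_deriv_time`), hence bounded on `M × [t₀ - 1, t₀ + 1]`, and the Riemannian measure
is finite; apply `hasDerivAt_integral_of_dominated_loc_of_deriv_le`.
[cite: EellsRatto1993, Ch. I (1.8)–(1.9)] -/
theorem hasDerivAt_energy_family {F : ℝ → M → N}
    (hF : ContMDiff (𝓘(ℝ, ℝ).prod IM) IN ∞ (fun p : ℝ × M => F p.1 p.2)) (t₀ : ℝ) :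
    HasDerivAt (fun t => HarmonicMap.energy g h (F t))
      (∫ x, deriv (fun s => HarmonicMap.energyDensity g h (F s) x) t₀ ∂(riemannianMeasure g))
      t₀ := by
  haveI := isFiniteMeasure_riemannianMeasure' g
  have hu : ContMDiff (IM.prod 𝓘(ℝ, ℝ)) 𝓘(ℝ, ℝ) ∞
      (fun q : M × ℝ => HarmonicMap.energyDensity g h (F q.2) q.1) :=
    contMDiff_energyDensity_family g h hF
  have hUc : Continuous fun q : M × ℝ => HarmonicMap.energyDensity g h (F q.2) q.1 :=
    hu.continuous
  have hDc : Continuous fun z : M × ℝ =>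
      deriv (fun s => HarmonicMap.energyDensity g h (F s) z.1) z.2 :=
    continuous_deriv_time (u := fun t x => HarmonicMap.energyDensity g h (F t) x) hu
  -- slices are continuous (`Continuous.curry_left`), hence measurable and integrable
  have hslice : ∀ t, Continuous fun x => HarmonicMap.energyDensity g h (F t) x := fun t =>
    hUc.curry_left (y := t)
  have hDslice : ∀ t, Continuous fun x =>
      deriv (fun s => HarmonicMap.energyDensity g h (F s) x) t := fun t =>
    hDc.curry_left (y := t)
  -- uniform bounds on the compact set `M × [t₀ - 1, t₀ + 1]`
  have hK : IsCompact ((univ : Set M) ×ˢ Icc (t₀ - 1) (t₀ + 1)) :=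
    isCompact_univ.prod isCompact_Icc
  obtain ⟨C, hC⟩ := hK.exists_bound_of_continuousOn hDc.continuousOn
  obtain ⟨C₀, hC₀⟩ := (isCompact_univ (X := M)).exists_bound_of_continuousOn
    (hslice t₀).continuousOn
  have hball : ∀ t ∈ Metric.ball t₀ 1, t ∈ Icc (t₀ - 1) (t₀ + 1) := fun t ht => by
    rw [Metric.mem_ball, Real.dist_eq] at ht
    constructor <;> linarith [abs_lt.1 ht]
  have hint : Integrable (fun x => HarmonicMap.energyDensity g h (F t₀) x) (riemannianMeasure g) :=
    (integrable_const C₀).mono' (hslice t₀).aestronglyMeasurable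
      (Eventually.of_forall fun x => hC₀ x (mem_univ x))
  have hbound : ∀ᵐ x ∂(riemannianMeasure g), ∀ t ∈ Metric.ball t₀ 1,
      ‖deriv (fun s => HarmonicMap.energyDensity g h (F s) x) t‖ ≤ C :=
    Eventually.of_forall fun x t ht => hC (x, t) ⟨mem_univ x, hball t ht⟩
  have hdiff : ∀ᵐ x ∂(riemannianMeasure g), ∀ t ∈ Metric.ball t₀ 1,
      HasDerivAt (fun s => HarmonicMap.energyDensity g h (F s) x)
        (deriv (fun s => HarmonicMap.energyDensity g h (F s) x) t) t :=
    Eventually.of_forall fun x t _ =>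
      hasDerivAt_time_slice (u := fun t x => HarmonicMap.energyDensity g h (F t) x) hu x t
  exact (hasDerivAt_integral_of_dominated_loc_of_deriv_le
    (F := fun t x => HarmonicMap.energyDensity g h (F t) x)
    (F' := fun t x => deriv (fun s => HarmonicMap.energyDensity g h (F s) x) t)
    (Metric.ball_mem_nhds t₀ zero_lt_one)
    (Eventually.of_forall fun t => (hslice t).aestronglyMeasurable) hint
    (hDslice t₀).aestronglyMeasurable hbound (integrable_const C) hdiff).2

/-! ### Energy-minimising maps are harmonic -/

variable {g h} in
/-- **A smooth local minimiser of the energy along every smooth deformation is harmonic**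
(the variational definition of harmonicity, Eells–Ratto 1993, Ch. I (1.8): critical points of
`E`; a local minimum of the differentiable function `t ↦ E(F_t)` at `t = 0` is a critical
point, `IsLocalMin.hasDerivAt_eq_zero`). [cite: EellsRatto1993, Ch. I (1.8)–(1.9)] -/
theorem isHarmonicMap_of_isLocalMin {φ : M → N} (hφ : ContMDiff IM IN ∞ φ)
    (hmin : ∀ F : ℝ → M → N, ContMDiff (𝓘(ℝ, ℝ).prod IM) IN ∞ (fun p : ℝ × M => F p.1 p.2) →
      F 0 = φ → IsLocalMin (fun t : ℝ => HarmonicMap.energy g h (F t)) 0) :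
    IsHarmonicMap g h φ := by
  refine ⟨hφ, fun F hF h0 => ?_⟩
  have hd := hasDerivAt_energy_family g h hF 0
  rwa [(hmin F hF h0).hasDerivAt_eq_zero hd] at hd

omit [FiniteDimensional ℝ EM] [IsManifold IM ∞ M] [BoundarylessManifold IM M] [CompactSpace M]
  [T3Space M] [MeasurableSpace M] [BorelSpace M] [IsManifold IN ∞ N] in
/-- Every stage `F_t` of a `C^∞` deformation is homotopic to `F_0` (along `s ↦ F_{st}`).
[folklore] -/
theorem homotopic_family {F : ℝ → M → N}
    (hF : ContMDiff (𝓘(ℝ, ℝ).prod IM) IN ∞ (fun p : ℝ × M => F p.1 p.2)) (t : ℝ) :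
    (⟨F 0, (hF.comp (contMDiff_const.prodMk contMDiff_id)).continuous⟩ : C(M, N)).Homotopic
      ⟨F t, (hF.comp (contMDiff_const.prodMk contMDiff_id)).continuous⟩ :=
  ⟨{ toFun := fun q : unitInterval × M => F ((q.1 : ℝ) * t) q.2
     continuous_toFun := hF.continuous.comp
       (((continuous_subtype_val.comp continuous_fst).mul continuous_const).prodMk
         continuous_snd)
     map_zero_left := fun x => by
       change F (((0 : unitInterval) : ℝ) * t) x = F 0 x
       rw [Set.Icc.coe_zero, zero_mul]
     map_one_left := fun x => by
       change F (((1 : unitInterval) : ℝ) * t) x = F t x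
       rw [Set.Icc.coe_one, one_mul] }⟩

variable {g h} in
/-- **A smooth map minimising the energy in its homotopy class (among smooth maps) is
harmonic** (Eells–Sampson 1964, §1; Eells–Ratto 1993, Ch. I (1.8)–(1.9): the stages `F_t` of a
smooth deformation of `φ` are smooth maps homotopic to `φ`, so `t ↦ E(F_t)` has a minimum at
`t = 0`). This is the last step of every variational existence proof of harmonic maps
(minimise `E` in the homotopy class, prove regularity, conclude harmonicity).
[cite: EellsRatto1993, Ch. I (1.8)–(1.9)] -/
theorem isHarmonicMap_of_energy_le_of_homotopic {φ : M → N} (hφ : ContMDiff IM IN ∞ φ)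
    (hmin : ∀ (ψ : M → N) (hψ : ContMDiff IM IN ∞ ψ),
      (⟨φ, hφ.continuous⟩ : C(M, N)).Homotopic ⟨ψ, hψ.continuous⟩ →
        HarmonicMap.energy g h φ ≤ HarmonicMap.energy g h ψ) :
    IsHarmonicMap g h φ := by
  refine isHarmonicMap_of_isLocalMin hφ fun F hF h0 => ?_
  refine Filter.Eventually.of_forall fun t => ?_
  have hψ : ContMDiff IM IN ∞ (F t) := hF.comp (contMDiff_const.prodMk contMDiff_id)
  have hhom := homotopic_family hF t
  subst h0
  exact hmin (F t) hψ hhom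

end Energy

/-! ### Nonnegativity of the energy; constant maps are harmonic -/

section Const

variable {EM : Type*} [NormedAddCommGroup EM] [NormedSpace ℝ EM] [FiniteDimensional ℝ EM]
  {HM : Type*} [TopologicalSpace HM] {IM : ModelWithCorners ℝ EM HM}
  {M : Type*} [TopologicalSpace M] [ChartedSpace HM M] [IsManifold IM ∞ M]
  {EN : Type*} [NormedAddCommGroup EN] [NormedSpace ℝ EN]
  {HN : Type*} [TopologicalSpace HN] {IN : ModelWithCorners ℝ EN HN}
  {N : Type*} [TopologicalSpace N] [ChartedSpace HN N] [IsManifold IN ∞ N]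

variable (g : ContMDiffRiemannianMetric IM ∞ EM (TangentSpace IM : M → Type _))
  (h : PseudoRiemannianMetric IN ∞ EN (TangentSpace IN : N → Type _))

omit [IsManifold IN ∞ N] in
/-- **The metric trace of a nonnegative form is nonnegative** for a Riemannian bundle metric:
in a `g_x`-orthonormal basis (`exists_orthonormal_basis`) the Gram matrix is `1` and
`tr_g T = ∑ᵢ T(eᵢ, eᵢ)` (`trace_eq_sum_gram_inv`). [folklore] -/
theorem trace_nonneg_of_isRiemannian (g' : PseudoRiemannianMetric IM ∞ EM (TangentSpace IM : M → Type _))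
    (hg' : g'.IsRiemannian) (x : M) (T : LinearMap.BilinForm ℝ (TangentSpace IM x))
    (hT : ∀ v, 0 ≤ T v v) : 0 ≤ g'.trace x T := by
  classical
  obtain ⟨e, he⟩ := g'.exists_orthonormal_basis x hg'
  have hG : (Matrix.of fun i j => g'.val x (e i) (e j)) = 1 := by
    ext i j
    rw [Matrix.of_apply, he i j, Matrix.one_apply]
  rw [trace_eq_sum_gram_inv g' x e T, hG, inv_one]
  refine Finset.sum_nonneg fun i _ => Finset.sum_nonneg fun j _ => ?_
  rw [Matrix.one_apply]
  split_ifs with hji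
  · subst hji
    rw [one_mul]
    exact hT (e j)
  · rw [zero_mul]

/-- **The energy density is nonnegative** for a Riemannian target metric `h`:
`e(φ)(x) = ½ tr_g (φ^* h)_x` with `(φ^* h)_x(v, v) = h(dφ v, dφ v) ≥ 0` (Eells–Ratto 1993, Ch. I
(1.3): `e(φ) = ½ |dφ|² ≥ 0`). [cite: EellsRatto1993, Ch. I (1.3)] -/
theorem energyDensity_nonneg (hh : h.IsRiemannian) (φ : M → N) (x : M) :
    0 ≤ HarmonicMap.energyDensity g h φ x := by
  rw [HarmonicMap.energyDensity_eq]
  refine mul_nonneg (by norm_num) (trace_nonneg_of_isRiemannian (ofRiemannian g)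
    (isRiemannian_ofRiemannian g) x _ fun v => ?_)
  change 0 ≤ pullbackBilin (I := IN) (I' := IM) φ h.val x v v
  rw [pullbackBilin_apply]
  by_cases hv : mfderiv IM IN φ x v = 0
  · simp [hv]
  · exact (hh (φ x) _ hv).le

variable [T3Space M] [MeasurableSpace M] [BorelSpace M]

/-- **The energy is nonnegative** for a Riemannian target metric (Eells–Ratto 1993, Ch. I
(1.4); the Bochner integral of a nonnegative function, integrable or not).
[cite: EellsRatto1993, Ch. I (1.4)] -/
theorem energy_nonneg (hh : h.IsRiemannian) (φ : M → N) : 0 ≤ HarmonicMap.energy g h φ :=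
  integral_nonneg fun x => energyDensity_nonneg g h hh φ x

variable [BoundarylessManifold IM M] [CompactSpace M]

/-- **Constant maps are harmonic** (Eells–Ratto 1993, Ch. I (1.3): "`e(φ) ≡ 0` on an open set
iff `φ` is constant there", with (1.9)): on a compact manifold without boundary, for a
Riemannian target metric, a constant map is a global minimiser of the energy
(`E ≥ 0 = E(const)`), hence a critical point (`isHarmonicMap_of_isLocalMin`).
[cite: EellsRatto1993, Ch. I (1.3) and (1.9)] -/
theorem isHarmonicMap_const (hh : h.IsRiemannian) (p : N) : IsHarmonicMap g h (fun _ : M => p) := by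
  refine isHarmonicMap_of_isLocalMin contMDiff_const fun F hF h0 => ?_
  refine Filter.Eventually.of_forall fun t => ?_
  show HarmonicMap.energy g h (F 0) ≤ HarmonicMap.energy g h (F t)
  rw [h0, HarmonicMap.energy_const]
  exact energy_nonneg g h hh (F t)

/-- **The Eells–Sampson theorem for null-homotopic maps** needs no curvature hypothesis: a
continuous map homotopic to a constant is homotopic to a harmonic map — the constant map
(`isHarmonicMap_const`), in the format of `eellsSampson_existence` (`EellsSampson.lean`;
Carlson–Müller-Stach–Peters 2017, Thm. 14.1.3). [cite: EellsRatto1993, Ch. I (1.3) and (1.9)] -/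
theorem exists_isHarmonicMap_homotopic_of_homotopic_const (hh : h.IsRiemannian) (f : C(M, N))
    (p : N) (hf : f.Homotopic (ContinuousMap.const M p)) :
    ∃ (φ : M → N) (hφ : IsHarmonicMap g h φ), f.Homotopic ⟨φ, hφ.continuous⟩ :=
  ⟨fun _ => p, isHarmonicMap_const g h hh p, hf⟩

end Const

end Literature.Geometry.Riemannian

end
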